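import Summits.CriticalPhenomena.CardyFormulaZ2.Theorems.CardyMagicRigidityNestingRigidityNeckZ2RingIndexCells
import Summits.CriticalPhenomena.CardyFormulaZ2.Theorems.CardyMagicRigidityNestingRigidityGapHierarchy
import HarnessLib

/-!
# Crux `NestingRigidity`, line `pinch-resampling` (v4), stub S12: cell skeletons of the ring and the isolation of hierarchy nodes

Crux `Summit.CriticalPhenomena.CardyFormulaZ2.Theses.CardyMagicRigidity.NestingRigidity`
(stmt-CriticalPhenomena-4835), line `pinch-resampling` v4, stub S12 `stub_neckHookupCoarseZ2 : NeckHookupCoarseZ2`.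
Brick of the summation of the necklace bound `ZNodeAbsBoundChainA` (amended plan in the module docstring of
`…NestingRigidityGapEntropy`, worker W6a) joining the ring geometry (`…NeckZ2RingIndexCells`: cells `cellIdx`,
rotated indices `rotIdx`, centres `idxPt`, the good cut) to the one-dimensional hierarchy (`…GapHierarchy`).

* §1 `NeckCoarseZ2.CellSkeleton R ℓ Nc` — the positional part of a necklace skeleton: a cut `a₀ ∈ [0, Nc)` and the
  sorted rotated cells `0 = t 0 < t 1 < ⋯ < t (n-1) < Nc` with the WRAP PROPERTY (every inner gap is at most
  `Nc - t (n-1)`); `exists_cellSkeleton`: every nonempty finite set of ring offsets has a cell skeleton listing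
  exactly its rotated cells (`exists_good_cut` + sorting).
* §2 The gap sequence `gapZ` (last value: the root's outer gap `Groot`, a parameter), its outer gaps `gapOutZ`, and the
  bridge to `GapHierarchy` over `ℝ` (`gapOut_cast`, `span_cast`).
* §3 **Isolation of nodes** (registered anchor `cellSkeleton_isolation`).  For an index interval `[i, j]` and the
  centre `idxPt (t i)`: a ring point whose rotated cell is `t m`, `i ≤ m ≤ j`, is at sup distance
  `< (t j - t i + 1) ℓ` (`zNorm_sub_center_lt`); if instead `m < i` or `j < m` and `[i, j]` is not the root, it is at
  sup distance `≥ (ℓ G - 2ℓ + 1)/2`, `G = gapOutZ i j` (`le_two_mul_zNorm_sub_center`: the line distance is `≥ G` by the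
  boundary gaps, and the distance the other way round the ring is `≥ Nc - t (n-1) ≥ G` by the wrap property).  These
  are the hypotheses `hin`, `hout` of the node certificate `Necklace.exists_node_crossings` for the annulus
  `zAnn (x + idxPt (t i)) ((2 (t j - t i) + 3) ℓ) (ℓ ⌊G/8⌋)`.
-/

noncomputable section

namespace Summit.CriticalPhenomena.CardyFormulaZ2.Cruxes.NestingRigidity.PinchResampling

open Literature.Probability.Percolation Literature.Probability.LatticeModels
open ZPinchLocality Finset

namespace NeckCoarseZ2

/-! ## §1 Cell skeletons -/

/-- **Cell skeleton** of the ring `{|·|_∞ = R}` at resolution `ℓ` with `Nc` cells: a cut `a₀` and sorted rotated cells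
`0 = t 0 < ⋯ < t (n - 1) < Nc` whose inner gaps are at most the wrap gap `Nc - t (n - 1)`. -/
structure CellSkeleton (Nc : ℤ) where
  /-- The cut (a cell index). -/
  a₀ : ℤ
  /-- The number of occupied cells. -/
  n : ℕ
  /-- The sorted rotated cells (junk beyond `n`). -/
  t : ℕ → ℤ
  /-- The cut is a cell index. -/
  a₀_nonneg : 0 ≤ a₀
  /-- The cut is a cell index. -/
  a₀_lt : a₀ < Nc
  /-- At least one cell. -/
  one_le : 1 ≤ n
  /-- The cut is occupied: the first rotated cell is `0`. -/
  t_zero : t 0 = 0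
  /-- Sorted. -/
  t_lt_succ : ∀ m, m + 1 < n → t m < t (m + 1)
  /-- Rotated cells are `< Nc`. -/
  t_lt : ∀ m < n, t m < Nc
  /-- **Wrap property**: inner gaps are at most the wrap gap. -/
  wrap : ∀ m, m + 1 < n → t (m + 1) - t m ≤ Nc - t (n - 1)

namespace CellSkeleton

variable {Nc : ℤ} (S : CellSkeleton Nc)

/-- The rotated cells increase strictly. -/
theorem t_strictMono {m m' : ℕ} (h : m < m') (hm' : m' < S.n) : S.t m < S.t m' := by
  induction m' with
  | zero => exact absurd h (Nat.not_lt_zero m)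
  | succ k ih =>
    rcases Nat.lt_succ_iff_lt_or_eq.1 h with hlt | rfl
    · exact (ih hlt (by omega)).trans (S.t_lt_succ k hm')
    · exact S.t_lt_succ m hm'

/-- The rotated cells increase. -/
theorem t_mono {m m' : ℕ} (h : m ≤ m') (hm' : m' < S.n) : S.t m ≤ S.t m' := by
  rcases h.eq_or_lt with rfl | hlt
  · exact le_rfl
  · exact (S.t_strictMono hlt hm').le

/-- The rotated cells are nonnegative. -/
theorem t_nonneg {m : ℕ} (hm : m < S.n) : 0 ≤ S.t m := S.t_zero ▸ S.t_mono (Nat.zero_le m) hm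

/-- The rotated cells are at most the last one. -/
theorem t_le_last {m : ℕ} (hm : m < S.n) : S.t m ≤ S.t (S.n - 1) := S.t_mono (by omega) (by omega)

/-! ## §2 Gaps and the bridge to `GapHierarchy` -/

/-- **Gap sequence** (in cells): `t (m + 1) - t m` for the inner gaps, the parameter `Groot` from `m = n - 1` on. -/
def gapZ (Groot : ℤ) (m : ℕ) : ℤ := if m + 1 < S.n then S.t (m + 1) - S.t m else Groot

/-- **Outer gap** of the index interval `[i, j]` (in cells), mirroring `GapHierarchy.gapOut` with `N = n - 1`. -/
def gapOutZ (Groot : ℤ) (i j : ℕ) : ℤ :=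
  if 0 < i then (if j < S.n - 1 then min (S.gapZ Groot (i - 1)) (S.gapZ Groot j) else S.gapZ Groot (i - 1))
    else S.gapZ Groot j

variable (Groot : ℤ)

/-- Inner gaps are positive. -/
theorem gapZ_pos {m : ℕ} (hm : m + 1 < S.n) : 0 < S.gapZ Groot m := by
  simp only [gapZ, if_pos hm, sub_pos]
  exact S.t_lt_succ m hm

/-- Inner gaps are at most the wrap gap. -/
theorem gapZ_le_wrap {m : ℕ} (hm : m + 1 < S.n) : S.gapZ Groot m ≤ Nc - S.t (S.n - 1) := by
  simp only [gapZ, if_pos hm]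
  exact S.wrap m hm

/-- **Bridge**: the real outer gap of `GapHierarchy` is the cast of `gapOutZ`. -/
theorem gapOut_cast (i j : ℕ) :
    GapHierarchy.gapOut (S.n - 1) (fun m ↦ (S.gapZ Groot m : ℝ)) i j = (S.gapOutZ Groot i j : ℝ) := by
  unfold GapHierarchy.gapOut gapOutZ
  split_ifs <;> push_cast <;> rfl

/-- **Bridge**: the real span of `GapHierarchy` is `t j - t i` (for `i ≤ j ≤ n - 1`). -/
theorem span_cast {i j : ℕ} (hij : i ≤ j) (hj : j ≤ S.n - 1) :
    GapHierarchy.span (fun m ↦ (S.gapZ Groot m : ℝ)) i j = (S.t j - S.t i : ℝ) := by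
  induction j with
  | zero =>
    obtain rfl : i = 0 := Nat.le_zero.1 hij
    simp [GapHierarchy.span]
  | succ k ih =>
    rcases hij.eq_or_lt with rfl | hlt
    · simp [GapHierarchy.span]
    · have hk : i ≤ k := Nat.lt_succ_iff.1 hlt
      unfold GapHierarchy.span at ih ⊢
      rw [sum_Ico_succ_top hk, ih hk (by omega)]
      simp only [gapZ, if_pos (show k + 1 < S.n by omega)]
      push_cast
      ring

/-- The outer gap of a non-root interval is an inner gap: positive and at most the wrap gap, and it bounds the line
distance to every index outside the interval. -/
theorem gapOutZ_le {i j : ℕ} (hij : i ≤ j) (hj : j ≤ S.n - 1) (hroot : ¬ (i = 0 ∧ j = S.n - 1)) :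
    0 < S.gapOutZ Groot i j ∧ S.gapOutZ Groot i j ≤ Nc - S.t (S.n - 1) ∧
      (∀ m < i, S.gapOutZ Groot i j ≤ S.t i - S.t m) ∧ (∀ m, j < m → m < S.n → S.gapOutZ Groot i j ≤ S.t m - S.t i) := by
  -- the two candidate boundary gaps
  have hleft : 0 < i → 0 < S.gapZ Groot (i - 1) ∧ S.gapZ Groot (i - 1) ≤ Nc - S.t (S.n - 1) ∧
      S.gapZ Groot (i - 1) = S.t i - S.t (i - 1) := fun hi ↦ by
    have h : i - 1 + 1 < S.n := by omega
    refine ⟨S.gapZ_pos Groot h, S.gapZ_le_wrap Groot h, ?_⟩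
    simp only [gapZ, if_pos h]
    rw [show i - 1 + 1 = i by omega]
  have hright : j < S.n - 1 → 0 < S.gapZ Groot j ∧ S.gapZ Groot j ≤ Nc - S.t (S.n - 1) ∧
      S.gapZ Groot j = S.t (j + 1) - S.t j := fun hj' ↦ by
    have h : j + 1 < S.n := by omega
    exact ⟨S.gapZ_pos Groot h, S.gapZ_le_wrap Groot h, by simp only [gapZ, if_pos h]⟩
  -- line distances to indices outside
  have hL : ∀ m < i, S.t i - S.t (i - 1) ≤ S.t i - S.t m := fun m hm ↦ by
    have := S.t_mono (show m ≤ i - 1 by omega) (by omega)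
    omega
  have hR : ∀ m, j < m → m < S.n → S.t (j + 1) - S.t j ≤ S.t m - S.t i := fun m hm hmn ↦ by
    have h1 := S.t_mono (show j + 1 ≤ m by omega) hmn
    have h2 := S.t_mono hij (by omega)
    omega
  unfold gapOutZ
  by_cases hi : 0 < i
  · obtain ⟨h1, h2, h3⟩ := hleft hi
    rw [if_pos hi]
    by_cases hj' : j < S.n - 1
    · obtain ⟨h1', h2', h3'⟩ := hright hj'
      rw [if_pos hj']
      refine ⟨lt_min h1 h1', (min_le_left _ _).trans h2, fun m hm ↦ (min_le_left _ _).trans (h3 ▸ hL m hm),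
        fun m hm hmn ↦ (min_le_right _ _).trans (h3' ▸ hR m hm hmn)⟩
    · rw [if_neg hj']
      exact ⟨h1, h2, fun m hm ↦ h3 ▸ hL m hm, fun m hm hmn ↦ by omega⟩
  · rw [if_neg hi]
    have hi0 : i = 0 := by omega
    have hj' : j < S.n - 1 := by
      by_contra h
      exact hroot ⟨hi0, by omega⟩
    obtain ⟨h1', h2', h3'⟩ := hright hj'
    exact ⟨h1', h2', fun m hm ↦ by omega, fun m hm hmn ↦ h3' ▸ hR m hm hmn⟩

/-! ## §3 Isolation of nodes -/

variable {R ℓ : ℤ}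

/-- **Inner isolation**: a ring point whose rotated cell is `t m`, `i ≤ m ≤ j < n`, is at sup distance
`< (t j - t i + 1) ℓ` from the centre `idxPt (t i)` (`(Nc - 1) ℓ < 8R ≤ Nc ℓ`). -/
theorem zNorm_sub_center_lt (hℓ : 0 < ℓ) (hR : 1 ≤ R) (hNc : 8 * R ≤ Nc * ℓ) (hNc' : (Nc - 1) * ℓ < 8 * R)
    {d : Site 2} (hd : zNorm d = R) {i j m : ℕ} (him : i ≤ m) (hmj : m ≤ j) (hj : j < S.n)
    (hcell : rotIdx Nc S.a₀ (cellIdx R ℓ d) = S.t m) :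
    zNorm (d - idxPt R ℓ Nc S.a₀ (S.t i)) < (S.t j - S.t i + 1) * ℓ := by
  have hi : i < S.n := by omega
  have ht0 := S.t_nonneg hi
  have ht1 := S.t_lt i hi
  have h := zNorm_sub_lt_of_rotIdx hℓ hR hNc hd (zNorm_idxPt hℓ hNc' S.a₀_nonneg S.a₀_lt ht0 ht1) (a₀ := S.a₀)
  rw [rotIdx_cellIdx_idxPt hℓ hNc' S.a₀_nonneg S.a₀_lt ht0 ht1, hcell] at h
  have h1 := S.t_mono him (by omega)
  have h2 := S.t_mono hmj hj
  rw [abs_of_nonneg (by omega)] at h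
  have h3 : (S.t m - S.t i + 1) * ℓ ≤ (S.t j - S.t i + 1) * ℓ := mul_le_mul_of_nonneg_right (by omega) hℓ.le
  exact h.trans_le h3

/-- **Outer isolation**: a ring point whose rotated cell is `t m` with `m < i` or `j < m < n`, for a non-root
interval `[i, j]`, is at sup distance `≥ (ℓ G - 2ℓ + 1) / 2` from the centre `idxPt (t i)`, `G = gapOutZ i j`. -/
theorem le_two_mul_zNorm_sub_center (hℓ : 0 < ℓ) (hR : 1 ≤ R) (hNc : 8 * R ≤ Nc * ℓ) (hNc' : (Nc - 1) * ℓ < 8 * R)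
    {d : Site 2} (hd : zNorm d = R) {i j m : ℕ} (hij : i ≤ j) (hj : j ≤ S.n - 1) (hroot : ¬ (i = 0 ∧ j = S.n - 1))
    (hm : m < S.n) (hout : m < i ∨ j < m) (hcell : rotIdx Nc S.a₀ (cellIdx R ℓ d) = S.t m) :
    ℓ * S.gapOutZ Groot i j - 2 * ℓ + 1 ≤ 2 * zNorm (d - idxPt R ℓ Nc S.a₀ (S.t i)) := by
  have hi : i < S.n := by omega
  have ht0 := S.t_nonneg hi
  have ht1 := S.t_lt i hi
  have h := le_two_mul_zNorm_sub_of_rotIdx hℓ hR hNc hNc' hd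
    (zNorm_idxPt hℓ hNc' S.a₀_nonneg S.a₀_lt ht0 ht1) (a₀ := S.a₀)
  rw [rotIdx_cellIdx_idxPt hℓ hNc' S.a₀_nonneg S.a₀_lt ht0 ht1, hcell] at h
  obtain ⟨-, hGwrap, hGl, hGr⟩ := S.gapOutZ_le Groot hij hj hroot
  set G := S.gapOutZ Groot i j
  -- `G ≤ Δ` and `G ≤ Nc - Δ`
  have hΔ : G ≤ |S.t m - S.t i| := by
    rcases hout with h' | h'
    · rw [abs_of_nonpos (by have := S.t_mono h'.le hi; omega)]
      have := hGl m h'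
      omega
    · rw [abs_of_nonneg (by have := S.t_mono (hij.trans h'.le) hm; omega)]
      exact hGr m h' hm
  have hΔ' : G ≤ Nc - |S.t m - S.t i| := by
    have h1 := S.t_nonneg hm
    have h2 := S.t_le_last hm
    have h3 := S.t_le_last hi
    have : |S.t m - S.t i| ≤ S.t (S.n - 1) := by
      rw [abs_le]
      constructor <;> omega
    omega
  have key : ℓ * G ≤ min (ℓ * |S.t m - S.t i|) (ℓ * (Nc - |S.t m - S.t i|)) :=
    le_min (mul_le_mul_of_nonneg_left hΔ hℓ.le) (mul_le_mul_of_nonneg_left hΔ' hℓ.le)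
  omega

/-! ## §4 Existence of a cell skeleton for a finite set of ring offsets -/

/-- **Every nonempty finite set of ring offsets has a cell skeleton listing exactly its rotated cells.** -/
theorem exists_cellSkeleton (hℓ : 0 < ℓ) (hR : 1 ≤ R) (hNc : 8 * R ≤ Nc * ℓ) (D : Finset (Site 2))
    (hne : D.Nonempty) (hD : ∀ d ∈ D, zNorm d = R) :
    ∃ S : CellSkeleton Nc, (∀ d ∈ D, ∃ m < S.n, rotIdx Nc S.a₀ (cellIdx R ℓ d) = S.t m) ∧
      ∀ m < S.n, ∃ d ∈ D, rotIdx Nc S.a₀ (cellIdx R ℓ d) = S.t m := by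
  classical
  -- the occupied cells and the good cut
  set C₀ := D.image (cellIdx R ℓ) with hC₀
  have hC₀ne : C₀.Nonempty := hne.image _
  have hC₀r : ∀ C ∈ C₀, 0 ≤ C ∧ C < Nc := fun C hC ↦ by
    obtain ⟨d, hd, rfl⟩ := mem_image.1 hC
    exact ⟨cellIdx_nonneg hℓ (hD d hd), cellIdx_lt hℓ hR (hD d hd) hNc⟩
  obtain ⟨a₀, ha₀, hcut⟩ := exists_good_cut C₀ hC₀ne hC₀r
  obtain ⟨ha₀0, ha₀1⟩ := hC₀r a₀ ha₀
  -- the sorted rotated cells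
  set T := C₀.image (rotIdx Nc a₀) with hT
  have hTne : T.Nonempty := hC₀ne.image _
  set n := T.card with hn
  have hn1 : 1 ≤ n := hTne.card_pos
  set e : Fin n ↪o ℤ := T.orderEmbOfFin rfl with he
  set t : ℕ → ℤ := fun m ↦ if h : m < n then e ⟨m, h⟩ else 0 with htdef
  have ht : ∀ m (h : m < n), t m = e ⟨m, h⟩ := fun m h ↦ dif_pos h
  have hmemT : ∀ m (h : m < n), t m ∈ T := fun m h ↦ by rw [ht m h]; exact T.orderEmbOfFin_mem rfl _
  have hsurj : ∀ y ∈ T, ∃ m < n, t m = y := fun y hy ↦ by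
    have : y ∈ Set.range e := by rw [he, range_orderEmbOfFin]; exact hy
    obtain ⟨⟨m, hm⟩, rfl⟩ := this
    exact ⟨m, hm, ht m hm⟩
  have hTr : ∀ y ∈ T, 0 ≤ y ∧ y < Nc := fun y hy ↦ by
    obtain ⟨C, hC, rfl⟩ := mem_image.1 hy
    exact ⟨rotIdx_nonneg ha₀1 (hC₀r C hC).1, rotIdx_lt ha₀0 (hC₀r C hC).2⟩
  have hmono : ∀ m m' (h : m < n) (h' : m' < n), m < m' → t m < t m' := fun m m' h h' hmm ↦ by
    rw [ht m h, ht m' h']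
    exact e.strictMono (Fin.mk_lt_mk.2 hmm)
  -- `t 0 = 0`: the cut is occupied and `0` is the least value
  have h0T : (0 : ℤ) ∈ T := mem_image.2 ⟨a₀, ha₀, rotIdx_self⟩
  have ht0 : t 0 = 0 := by
    obtain ⟨m, hm, hm0⟩ := hsurj 0 h0T
    have h1 : 0 ≤ t 0 := (hTr _ (hmemT 0 (by omega))).1
    rcases Nat.eq_zero_or_pos m with rfl | hpos
    · exact hm0
    · have := hmono 0 m (by omega) hm hpos
      omega
  -- the wrap property from the good cut
  have hwrap : ∀ m, m + 1 < n → t (m + 1) - t m ≤ Nc - t (n - 1) := by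
    intro m hm
    obtain ⟨u, hu, hut⟩ := mem_image.1 (hmemT m (by omega))
    obtain ⟨v, hv, hvt⟩ := mem_image.1 (hmemT (m + 1) hm)
    obtain ⟨w, hw, hwt⟩ := mem_image.1 (hmemT (n - 1) (by omega))
    have h := hcut u hu v hv (by rw [hut, hvt]; exact hmono m (m + 1) (by omega) hm m.lt_succ_self)
      (fun z hz ↦ by
        obtain ⟨m', hm', hm't⟩ := hsurj _ (mem_image_of_mem _ hz)
        rw [hut, hvt, ← hm't]
        rcases le_or_gt m' m with hle | hlt
        · left
          rcases hle.eq_or_lt with rfl | hlt'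
          · exact le_rfl
          · exact (hmono m' m hm' (by omega) hlt').le
        · right
          rcases (Nat.succ_le_of_lt hlt).eq_or_lt with h' | h'
          · rw [show m' = m + 1 by omega]
          · exact (hmono (m + 1) m' hm hm' h').le) w hw
    rwa [hut, hvt, hwt] at h
  refine ⟨⟨a₀, n, t, ha₀0, ha₀1, hn1, ht0, fun m hm ↦ hmono m (m + 1) (by omega) hm m.lt_succ_self,
    fun m hm ↦ (hTr _ (hmemT m hm)).2, hwrap⟩, fun d hd ↦ ?_, fun m hm ↦ ?_⟩
  · obtain ⟨m, hm, hmt⟩ := hsurj _ (mem_image_of_mem _ (mem_image_of_mem _ hd))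
    exact ⟨m, hm, hmt.symm⟩
  · obtain ⟨C, hC, hCt⟩ := mem_image.1 (hmemT m hm)
    obtain ⟨d, hd, rfl⟩ := mem_image.1 hC
    exact ⟨d, hd, hCt⟩

end CellSkeleton

end NeckCoarseZ2

/-- **Isolation of hierarchy nodes on a cell skeleton (registered helper, anchor of this module on the crux item).**
For a cell skeleton `S` of the ring (`(Nc - 1) ℓ < 8R ≤ Nc ℓ`, `ℓ ≥ 1`, `R ≥ 1`), an index interval `i ≤ j < n` with
centre `idxPt (t i)`, and a ring point `d` of rotated cell `t m`: if `i ≤ m ≤ j` then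
`|d - centre|_∞ < (t j - t i + 1) ℓ`; if `m < i` or `j < m` and `[i, j]` is not the root then
`ℓ · gapOutZ i j - 2ℓ + 1 ≤ 2 |d - centre|_∞` (`CellSkeleton.zNorm_sub_center_lt`,
`CellSkeleton.le_two_mul_zNorm_sub_center`). -/
theorem cellSkeleton_isolation : ∀ (R ℓ Nc Groot : ℤ) (S : NeckCoarseZ2.CellSkeleton Nc) (d : Site 2) (i j m : ℕ), 0 < ℓ → 1 ≤ R → 8 * R ≤ Nc * ℓ → (Nc - 1) * ℓ < 8 * R → zNorm d = R → NeckCoarseZ2.rotIdx Nc S.a₀ (NeckCoarseZ2.cellIdx R ℓ d) = S.t m → m < S.n → i ≤ j → j < S.n → ((i ≤ m ∧ m ≤ j) → zNorm (d - NeckCoarseZ2.idxPt R ℓ Nc S.a₀ (S.t i)) < (S.t j - S.t i + 1) * ℓ) ∧ ((m < i ∨ j < m) → ¬ (i = 0 ∧ j = S.n - 1) → ℓ * S.gapOutZ Groot i j - 2 * ℓ + 1 ≤ 2 * zNorm (d - NeckCoarseZ2.idxPt R ℓ Nc S.a₀ (S.t i))) :=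
  fun _ _ _ Groot S _ _ _ _ hℓ hR hNc hNc' hd hcell hm hij hj ↦
    ⟨fun h ↦ S.zNorm_sub_center_lt hℓ hR hNc hNc' hd h.1 h.2 hj hcell,
      fun h hroot ↦ S.le_two_mul_zNorm_sub_center Groot hℓ hR hNc hNc' hd hij (by omega) hroot hm h hcell⟩

end Summit.CriticalPhenomena.CardyFormulaZ2.Cruxes.NestingRigidity.PinchResampling

end
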